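import Summits.FinalStateConjecture.FinalStateConjecture.Theses.MergerLatticeBudget

/-!
# Route MergerLatticeBudget — `PartitionSandwich` (item `stmt-FinalStateConjecture-10233`)

The ℓ²/ℓ¹ partition arithmetic of card P1 (partition-arithmetic-merger-lattice), pure real
analysis. For nonnegative `m : Fin n → ℝ` and a surjective block map `c : Fin n → Fin p`, write
`B j = ∑_{i : c i = j} (m i)²` for the squared ℓ²-mass of block `j`. Then

* `√(∑ i, (m i)²) ≤ ∑ j, √(B j)` — subadditivity of `√` over the fibrewise decomposition
  `∑ i, (m i)² = ∑ j, B j`;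
* `∑ j, √(B j) ≤ ∑ i, m i` — blockwise `ℓ² ≤ ℓ¹` for nonnegative entries, summed fibrewise;
* `p · μ ≤ ∑ j, √(B j)` whenever `μ ≤ m i` for all `i` — every block is nonempty by surjectivity
  and its ℓ²-mass dominates any single entry (the survivor count: at most budget/μ blocks).

Only `Finset.sum`, `Real.sqrt`, `Finset.filter` from Mathlib are used; the two auxiliary lemmas
(subadditivity of `√` over finite sums, blockwise `ℓ² ≤ ℓ¹`) are elementary facts about
`Real.sqrt` recorded here because Mathlib states subadditivity of `x ↦ x ^ p` only in `rpow` form.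
-/

-- the doubled `FinalStateConjecture.FinalStateConjecture` path component (single-conjunct summit,
-- D-0017 layout) trips dupNamespace on every declaration of this namespace
set_option linter.dupNamespace false

namespace Summit.FinalStateConjecture.FinalStateConjecture.Theorems

open Finset

/-- `Real.sqrt` is subadditive over finite sums: `√(∑ᵢ fᵢ) ≤ ∑ᵢ √fᵢ` (no sign hypothesis:
`√` vanishes on the nonpositive reals, so `√(x + y) ≤ √x + √y` holds on all of `ℝ`). -/
theorem partitionSandwich_sqrt_sum_le {ι : Type*} (s : Finset ι) (f : ι → ℝ) :
    Real.sqrt (∑ i ∈ s, f i) ≤ ∑ i ∈ s, Real.sqrt (f i) := by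
  -- every real is at most the square of its truncated square root
  have hsq : ∀ x : ℝ, x ≤ Real.sqrt x ^ 2 := fun x => by
    rcases le_or_gt 0 x with h | h
    · rw [Real.sq_sqrt h]
    · exact h.le.trans (sq_nonneg _)
  refine Finset.le_sum_of_subadditive Real.sqrt Real.sqrt_zero.le (fun x y => ?_) s f
  have hx := hsq x
  have hy := hsq y
  have h0 : 0 ≤ Real.sqrt x + Real.sqrt y := add_nonneg (Real.sqrt_nonneg _) (Real.sqrt_nonneg _)
  calc Real.sqrt (x + y) ≤ Real.sqrt ((Real.sqrt x + Real.sqrt y) ^ 2) :=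
        Real.sqrt_le_sqrt (by nlinarith [Real.sqrt_nonneg x, Real.sqrt_nonneg y])
    _ = Real.sqrt x + Real.sqrt y := Real.sqrt_sq h0

/-- Blockwise `ℓ² ≤ ℓ¹`: for nonnegative entries, `√(∑ᵢ fᵢ²) ≤ ∑ᵢ fᵢ`. -/
theorem partitionSandwich_sqrt_sum_sq_le {ι : Type*} (s : Finset ι) (f : ι → ℝ)
    (hf : ∀ i ∈ s, 0 ≤ f i) : Real.sqrt (∑ i ∈ s, f i ^ 2) ≤ ∑ i ∈ s, f i := by
  have hS : 0 ≤ ∑ i ∈ s, f i := Finset.sum_nonneg hf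
  have hle : ∑ i ∈ s, f i ^ 2 ≤ (∑ i ∈ s, f i) ^ 2 := by
    calc ∑ i ∈ s, f i ^ 2 ≤ ∑ i ∈ s, f i * ∑ k ∈ s, f k :=
          Finset.sum_le_sum fun i hi => by
            rw [sq]
            exact mul_le_mul_of_nonneg_left (Finset.single_le_sum hf hi) (hf i hi)
      _ = (∑ i ∈ s, f i) ^ 2 := by rw [← Finset.sum_mul, sq]
  calc Real.sqrt (∑ i ∈ s, f i ^ 2) ≤ Real.sqrt ((∑ i ∈ s, f i) ^ 2) := Real.sqrt_le_sqrt hle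
    _ = ∑ i ∈ s, f i := Real.sqrt_sq hS

/-- **`PartitionSandwich` holds** (item `stmt-FinalStateConjecture-10233`, card P1 of route
MergerLatticeBudget): for nonnegative `m : Fin n → ℝ` and a surjective block map
`c : Fin n → Fin p`, the ℓ²/ℓ¹ sandwich `‖m‖₂ ≤ Σ_blocks ‖m|_block‖₂ ≤ ‖m‖₁`, and the survivor
count `p · μ ≤ Σ_blocks ‖m|_block‖₂` for every common lower bound `μ` of the `m i`.
Proof: fibrewise summation along `c` (`Finset.sum_fiberwise`), subadditivity of `√`
(`partitionSandwich_sqrt_sum_le`), blockwise `ℓ² ≤ ℓ¹` (`partitionSandwich_sqrt_sum_sq_le`),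
and `μ ≤ m i₀ = √(m i₀ ²) ≤ √(B (c i₀))` for a preimage `i₀` of each block. -/
theorem PartitionSandwich_proof :
    Summit.FinalStateConjecture.FinalStateConjecture.Theses.MergerLatticeBudget.PartitionSandwich := by
  unfold Theses.MergerLatticeBudget.PartitionSandwich
  intro n p m c hm hc
  -- fibrewise decompositions of the ℓ² and ℓ¹ sums along the block map `c`
  have hfib2 : ∑ j, ∑ i ∈ Finset.univ.filter (fun i => c i = j), m i ^ 2 = ∑ i, m i ^ 2 :=
    Finset.sum_fiberwise Finset.univ c fun i => m i ^ 2
  have hfib1 : ∑ j, ∑ i ∈ Finset.univ.filter (fun i => c i = j), m i = ∑ i, m i :=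
    Finset.sum_fiberwise Finset.univ c m
  refine ⟨?_, ?_, ?_⟩
  · rw [← hfib2]
    exact partitionSandwich_sqrt_sum_le _ _
  · rw [← hfib1]
    exact Finset.sum_le_sum fun j _ =>
      partitionSandwich_sqrt_sum_sq_le _ _ fun i _ => hm i
  · intro μ hμ
    have hblock : ∀ j, μ ≤ Real.sqrt (∑ i ∈ Finset.univ.filter (fun i => c i = j), m i ^ 2) := by
      intro j
      obtain ⟨i₀, hi₀⟩ := hc j
      have hmem : i₀ ∈ Finset.univ.filter (fun i => c i = j) := by simp [hi₀]
      calc μ ≤ m i₀ := hμ i₀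
        _ = Real.sqrt (m i₀ ^ 2) := (Real.sqrt_sq (hm i₀)).symm
        _ ≤ Real.sqrt (∑ i ∈ Finset.univ.filter (fun i => c i = j), m i ^ 2) :=
          Real.sqrt_le_sqrt
            (Finset.single_le_sum (f := fun i => m i ^ 2) (fun i _ => sq_nonneg (m i)) hmem)
    calc (p : ℝ) * μ = ∑ _j : Fin p, μ := by simp
      _ ≤ _ := Finset.sum_le_sum fun j _ => hblock j

end Summit.FinalStateConjecture.FinalStateConjecture.Theorems
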